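import Literature.Analysis.InnerProduct.RankOneSpike
import Literature.Probability.RandomGraphs.PlantedCliqueCleanup
import Mathlib.Analysis.Matrix.Hermitian
import Mathlib.Analysis.Normed.Lp.Matrix
import HarnessLib

/-!
# Planted clique: the deterministic core of the spectral algorithm

The sign matrix `B = 2A - J + I` of a graph `G` on a finite vertex set `V` (`0` on the diagonal,
`+1` on edges, `-1` on non-edges; `signMatrix`, integer-valued so that a machine can iterate it
exactly) decomposes, for a clique `T` of size `k`, as

  `B = k e eᵀ - diag(1_T) + R`,  `e = 1_T/√k`,  `Rᵢⱼ = 0` if `i, j ∈ T`, `= Bᵢⱼ` otherwise.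

**Theorem `spectral_core`.** Suppose the "random part" is small in bilinear form,
`Σᵢⱼ Rᵢⱼ aᵢ bⱼ ≤ ρ₀ ‖a‖ ‖b‖`, every vertex outside `T` has `< 7k/12` neighbours in `T`,
`k ≥ 64 (ρ₀ + 1)` and `2ᵗ ≥ 32 √k`. Then some column `j ∈ T` of the integer matrix `Bᵗ` is a
good direction: for EVERY `k`-set `W` of coordinates of that column dominating the others in
absolute value, the `3k/4`-neighbour test in `W` returns exactly `T`.

This is the deterministic content of Alon–Krivelevich–Sudakov 1998, §2.2 (there phrased for the
exact second eigenvector of `A`; here for `t` steps of power iteration on the centred matrix,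
which a Turing machine performs in exact arithmetic), assembled from
`Literature.Analysis.InnerProduct.exists_top_eigenvector` (spike + perturbation),
`card_sdiff_le_of_top_selection` and `filter_threeQuarters_eq` (`PlantedCliqueCleanup.lean`).
The probabilistic inputs (the bound on `R` for `G(n,1/2)` with a planted clique, and the degree
condition) are supplied elsewhere.

## References

* N. Alon, M. Krivelevich, B. Sudakov, *Finding a large hidden clique in a random graph*, Random
  Structures Algorithms 13 (1998) 457–466, §2.1–2.2 [AlonKrivelevichSudakov1998].
-/

noncomputable section

open Finset Matrix
open scoped InnerProductSpace RealInnerProductSpace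

namespace Literature.Probability.RandomGraphs.PlantedClique

open Literature.Analysis.InnerProduct

variable {V : Type*} [DecidableEq V]

section SignMatrix

/-! ### The sign matrix -/

/-- The sign matrix `B = 2A - J + I` of a graph: `Bᵢᵢ = 0`, `Bᵢⱼ = 1` if `i ~ j`, `-1` otherwise.
(AKS 1998 work with the adjacency matrix `A`; `B` is its centred version, with the same
eigenvectors as `A - (J - I)/2`.) [folklore] -/
def signMatrix (G : SimpleGraph V) [DecidableRel G.Adj] : Matrix V V ℤ :=
  Matrix.of fun i j => if i = j then 0 else if G.Adj i j then 1 else -1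

/-- Entries of the sign matrix. [folklore] -/
theorem signMatrix_apply (G : SimpleGraph V) [DecidableRel G.Adj] (i j : V) :
    signMatrix G i j = if i = j then 0 else if G.Adj i j then 1 else -1 := rfl

/-- The sign matrix is symmetric. [folklore] -/
theorem signMatrix_symm_apply (G : SimpleGraph V) [DecidableRel G.Adj] (i j : V) :
    signMatrix G j i = signMatrix G i j := by
  rw [signMatrix_apply, signMatrix_apply]
  by_cases h : i = j
  · subst h; rfl
  · rw [if_neg (Ne.symm h), if_neg h]
    simp only [G.adj_comm]

/-- Entries of the real sign matrix `(signMatrix G).map (↑)`. [folklore] -/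
theorem signMatrix_map_apply (G : SimpleGraph V) [DecidableRel G.Adj] (i j : V) :
    (signMatrix G).map (Int.cast : ℤ → ℝ) i j =
      if i = j then (0 : ℝ) else if G.Adj i j then 1 else -1 := by
  rw [map_apply, signMatrix_apply]
  split_ifs <;> simp

/-- The real sign matrix is Hermitian (symmetric). [folklore] -/
theorem isHermitian_signMatrix_map (G : SimpleGraph V) [DecidableRel G.Adj] :
    ((signMatrix G).map (Int.cast : ℤ → ℝ)).IsHermitian :=
  IsHermitian.ext fun i j => by rw [star_trivial, map_apply, map_apply, signMatrix_symm_apply]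

end SignMatrix

variable [Fintype V]

/-- Powers of the integer sign matrix, cast to `ℝ`, are the powers of the real sign matrix.
[folklore] -/
theorem cast_signMatrix_pow_apply (G : SimpleGraph V) [DecidableRel G.Adj] (t : ℕ) (i j : V) :
    ((signMatrix G ^ t) i j : ℝ) = ((signMatrix G).map (Int.cast : ℤ → ℝ) ^ t) i j := by
  have h := Matrix.map_pow (signMatrix G) (Int.castRingHom ℝ) t
  rw [Int.coe_castRingHom] at h
  rw [← h, map_apply]

/-! ### Euclidean bookkeeping -/

omit [DecidableEq V] in
/-- The real inner product on `EuclideanSpace ℝ V` in coordinates. [folklore] -/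
theorem euclidean_inner_eq (x y : EuclideanSpace ℝ V) : ⟪x, y⟫_ℝ = ∑ i, x i * y i := by
  rw [EuclideanSpace.inner_eq_star_dotProduct, star_trivial, dotProduct]
  exact sum_congr rfl fun i _ => mul_comm _ _

/-- The bilinear form of a real matrix on `EuclideanSpace`: `⟪M a, b⟫ = Σᵢⱼ Mᵢⱼ aⱼ bᵢ`.
[folklore] -/
theorem inner_toEuclideanLin (M : Matrix V V ℝ) (a b : EuclideanSpace ℝ V) :
    ⟪Matrix.toEuclideanLin M a, b⟫_ℝ = ∑ i, ∑ j, M i j * a j * b i := by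
  rw [euclidean_inner_eq]
  refine sum_congr rfl fun i _ => ?_
  have : (Matrix.toEuclideanLin M a) i = ∑ j, M i j * a j := by
    simp [Matrix.toLpLin_apply, Matrix.mulVec, dotProduct]
  rw [this, sum_mul]

/-- The normalised indicator `e = 1_T/√k` of a `k`-set is a unit vector (`k ≥ 1`). [folklore] -/
theorem norm_indicator_div_sqrt {k : ℕ} (hk : 1 ≤ k) {T : Finset V} (hT : T.card = k) :
    ‖(WithLp.toLp 2 fun i => if i ∈ T then 1 / Real.sqrt k else (0 : ℝ) : EuclideanSpace ℝ V)‖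
      = 1 := by
  have hk0 : (0 : ℝ) < k := by exact_mod_cast hk
  have hsq : ‖(WithLp.toLp 2 fun i => if i ∈ T then 1 / Real.sqrt k else (0 : ℝ) :
      EuclideanSpace ℝ V)‖ ^ 2 = 1 := by
    rw [EuclideanSpace.real_norm_sq_eq]
    have : ∀ i : V, ((WithLp.toLp 2 fun i => if i ∈ T then 1 / Real.sqrt k else (0 : ℝ) :
        EuclideanSpace ℝ V) i) ^ 2 = if i ∈ T then (1 : ℝ) / k else 0 := by
      intro i
      show (if i ∈ T then 1 / Real.sqrt k else (0 : ℝ)) ^ 2 = _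
      split_ifs
      · rw [div_pow, one_pow, Real.sq_sqrt hk0.le]
      · simp
    simp_rw [this]
    rw [Finset.sum_ite_mem univ T (fun _ => (1 : ℝ) / k), univ_inter, sum_const, hT,
      nsmul_eq_mul, mul_one_div_cancel hk0.ne']
  rw [← Real.sqrt_sq (norm_nonneg _), hsq, Real.sqrt_one]

/-! ### The spike bound for the sign matrix of a graph with a clique -/

omit [Fintype V] in
/-- Entrywise decomposition `B = k e eᵀ - diag(1_T) + R` for a clique `T` of size `k`.
[cite: AlonKrivelevichSudakov1998, §2.2 (decomposition `A = A₁ + A₂`)] -/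
theorem signMatrix_decomp (G : SimpleGraph V) [DecidableRel G.Adj] {k : ℕ} (hk : 1 ≤ k)
    {T : Finset V} (hclique : G.IsClique (T : Set V)) (i j : V) :
    (signMatrix G).map (Int.cast : ℤ → ℝ) i j =
      k * ((if i ∈ T then 1 / Real.sqrt k else 0) * (if j ∈ T then 1 / Real.sqrt k else 0))
        - (if i = j ∧ i ∈ T then 1 else 0)
        + (if i ∈ T ∧ j ∈ T then 0 else (signMatrix G).map (Int.cast : ℤ → ℝ) i j) := by
  have hk0 : (0 : ℝ) < k := by exact_mod_cast hk
  have hkk : (k : ℝ) * (1 / Real.sqrt k * (1 / Real.sqrt k)) = 1 := by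
    field_simp
    rw [Real.sq_sqrt hk0.le]
  by_cases hi : i ∈ T <;> by_cases hj : j ∈ T
  · -- both in `T`
    rw [if_pos hi, if_pos hj, if_pos (show i ∈ T ∧ j ∈ T from ⟨hi, hj⟩), hkk,
      signMatrix_map_apply]
    by_cases hij : i = j
    · rw [if_pos hij, if_pos (show i = j ∧ i ∈ T from ⟨hij, hi⟩)]; ring
    · rw [if_neg hij, if_neg (show ¬ (i = j ∧ i ∈ T) from fun h => hij h.1),
        if_pos (hclique hi hj hij)]; ring
  · rw [if_pos hi, if_neg hj, if_neg (show ¬ (i = j ∧ i ∈ T) from fun h => hj (h.1 ▸ h.2)),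
      if_neg (show ¬ (i ∈ T ∧ j ∈ T) from fun h => hj h.2)]
    ring
  · rw [if_neg hi, if_neg (show ¬ (i = j ∧ i ∈ T) from fun h => hi h.2),
      if_neg (show ¬ (i ∈ T ∧ j ∈ T) from fun h => hi h.1)]
    ring
  · rw [if_neg hi, if_neg (show ¬ (i = j ∧ i ∈ T) from fun h => hi h.2),
      if_neg (show ¬ (i ∈ T ∧ j ∈ T) from fun h => hi h.1)]
    ring

omit [DecidableEq V] in
/-- Cauchy–Schwarz on a subset: `-Σ_{i ∈ T} aᵢ bᵢ ≤ ‖a‖ ‖b‖`. [folklore] -/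
theorem neg_sum_mul_le_norm_mul_norm (T : Finset V) (a b : EuclideanSpace ℝ V) :
    -∑ i ∈ T, a i * b i ≤ ‖a‖ * ‖b‖ := by
  have hcs := sum_mul_sq_le_sq_mul_sq T (fun i => a i) (fun i => b i)
  have ha : ∑ i ∈ T, a i ^ 2 ≤ ‖a‖ ^ 2 := by
    rw [EuclideanSpace.real_norm_sq_eq]
    exact sum_le_sum_of_subset_of_nonneg (subset_univ _) fun i _ _ => sq_nonneg _
  have hb : ∑ i ∈ T, b i ^ 2 ≤ ‖b‖ ^ 2 := by
    rw [EuclideanSpace.real_norm_sq_eq]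
    exact sum_le_sum_of_subset_of_nonneg (subset_univ _) fun i _ _ => sq_nonneg _
  have h2 : (∑ i ∈ T, a i * b i) ^ 2 ≤ (‖a‖ * ‖b‖) ^ 2 := by
    rw [mul_pow]
    exact hcs.trans (mul_le_mul ha hb (sum_nonneg fun i _ => sq_nonneg _) (sq_nonneg _))
  have habs := abs_le_of_sq_le_sq h2 (by positivity)
  linarith [neg_abs_le (∑ i ∈ T, a i * b i)]

/-- **The spike bound**: if the random part satisfies `Σ Rᵢⱼ aᵢ bⱼ ≤ ρ₀ ‖a‖ ‖b‖` then the sign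
matrix operator `B` satisfies `⟪B a, b⟫ ≤ k ⟪e, a⟫ ⟪e, b⟫ + (ρ₀ + 1) ‖a‖ ‖b‖` with `e = 1_T/√k`.
[cite: AlonKrivelevichSudakov1998, §2.2 (Prop. 2.1)] -/
theorem spike_bound_signMatrix (G : SimpleGraph V) [DecidableRel G.Adj] {k : ℕ} (hk : 1 ≤ k)
    {T : Finset V} (hclique : G.IsClique (T : Set V)) {ρ₀ : ℝ}
    (hR : ∀ a b : EuclideanSpace ℝ V,
      ∑ i, ∑ j, (if i ∈ T ∧ j ∈ T then 0 else (signMatrix G).map (Int.cast : ℤ → ℝ) i j)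
        * a i * b j ≤ ρ₀ * ‖a‖ * ‖b‖)
    (a b : EuclideanSpace ℝ V) :
    ⟪Matrix.toEuclideanLin ((signMatrix G).map (Int.cast : ℤ → ℝ)) a, b⟫_ℝ ≤
      k * ⟪(WithLp.toLp 2 fun i => if i ∈ T then 1 / Real.sqrt k else (0 : ℝ) :
          EuclideanSpace ℝ V), a⟫_ℝ *
        ⟪(WithLp.toLp 2 fun i => if i ∈ T then 1 / Real.sqrt k else (0 : ℝ) :
          EuclideanSpace ℝ V), b⟫_ℝ + (ρ₀ + 1) * ‖a‖ * ‖b‖ := by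
  set B := (signMatrix G).map (Int.cast : ℤ → ℝ) with hB
  set ev : V → ℝ := fun i => if i ∈ T then 1 / Real.sqrt k else 0 with hev
  -- symmetrise the bilinear form
  have hsym : ⟪Matrix.toEuclideanLin B a, b⟫_ℝ = ∑ i, ∑ j, B i j * a i * b j := by
    rw [inner_toEuclideanLin, sum_comm]
    refine sum_congr rfl fun i _ => sum_congr rfl fun j _ => ?_
    rw [hB, map_apply, map_apply, signMatrix_symm_apply]
  -- split `B = k e eᵀ - D + R`
  have hentry : ∀ i j, B i j * a i * b j =
      k * ((ev i * a i) * (ev j * b j)) - (if i = j ∧ i ∈ T then 1 else 0) * a i * b j +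
        (if i ∈ T ∧ j ∈ T then 0 else B i j) * a i * b j := by
    intro i j
    have hdec := signMatrix_decomp G hk hclique i j
    rw [← hB] at hdec
    conv_lhs => rw [hdec]
    simp only [hev]
    ring
  have hP : ∑ i, ∑ j, (k : ℝ) * ((ev i * a i) * (ev j * b j)) =
      k * ((∑ i, ev i * a i) * ∑ j, ev j * b j) := by
    rw [sum_mul_sum, mul_sum]
    refine sum_congr rfl fun i _ => ?_
    rw [mul_sum]
  have hD : ∑ i, ∑ j, (if i = j ∧ i ∈ T then (1 : ℝ) else 0) * a i * b j = ∑ i ∈ T, a i * b i := by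
    have hrow : ∀ i, ∑ j, (if i = j ∧ i ∈ T then (1 : ℝ) else 0) * a i * b j =
        if i ∈ T then a i * b i else 0 := by
      intro i
      rw [Finset.sum_eq_single i]
      · by_cases hi : i ∈ T
        · rw [if_pos (show i = i ∧ i ∈ T from ⟨rfl, hi⟩), if_pos hi, one_mul]
        · rw [if_neg (show ¬ (i = i ∧ i ∈ T) from fun h => hi h.2), if_neg hi]; ring
      · intro j _ hji
        rw [if_neg (show ¬ (i = j ∧ i ∈ T) from fun h => hji h.1.symm)]; ring
      · intro h; exact absurd (mem_univ i) h
    simp_rw [hrow]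
    rw [Finset.sum_ite_mem univ T (fun i => a i * b i), univ_inter]
  have hsplit : ∑ i, ∑ j, B i j * a i * b j =
      k * ((∑ i, ev i * a i) * ∑ j, ev j * b j) - ∑ i ∈ T, a i * b i +
        ∑ i, ∑ j, (if i ∈ T ∧ j ∈ T then 0 else B i j) * a i * b j := by
    calc ∑ i, ∑ j, B i j * a i * b j
        = ∑ i, ∑ j, (k * ((ev i * a i) * (ev j * b j)) -
            (if i = j ∧ i ∈ T then 1 else 0) * a i * b j +
            (if i ∈ T ∧ j ∈ T then 0 else B i j) * a i * b j) :=
          sum_congr rfl fun i _ => sum_congr rfl fun j _ => hentry i j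
      _ = ∑ i, ∑ j, (k : ℝ) * ((ev i * a i) * (ev j * b j)) -
            ∑ i, ∑ j, (if i = j ∧ i ∈ T then (1 : ℝ) else 0) * a i * b j +
            ∑ i, ∑ j, (if i ∈ T ∧ j ∈ T then 0 else B i j) * a i * b j := by
          simp only [sum_add_distrib, sum_sub_distrib]
      _ = _ := by rw [hP, hD]
  have hea : ⟪(WithLp.toLp 2 ev : EuclideanSpace ℝ V), a⟫_ℝ = ∑ i, ev i * a i := by
    rw [euclidean_inner_eq]
  have heb : ⟪(WithLp.toLp 2 ev : EuclideanSpace ℝ V), b⟫_ℝ = ∑ j, ev j * b j := by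
    rw [euclidean_inner_eq]
  rw [hsym, hsplit, hea, heb]
  have h1 := neg_sum_mul_le_norm_mul_norm T a b
  have h2 := hR a b
  nlinarith [h1, h2]

/-! ### A good coordinate of the top eigenvector -/

/-- If a unit vector `u` is within `1/16` of `e = 1_T/√k` then some coordinate `j ∈ T` has
`u j ≥ 1/(2√k)`. [folklore] -/
theorem exists_coord_ge_of_norm_sub_le {k : ℕ} (hk : 1 ≤ k) {T : Finset V} (hT : T.card = k)
    {u : EuclideanSpace ℝ V} (hu : ‖u‖ = 1)
    (hue : ‖u - (WithLp.toLp 2 fun i => if i ∈ T then 1 / Real.sqrt k else (0 : ℝ))‖ ≤ 1 / 16) :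
    ∃ j ∈ T, 1 / (2 * Real.sqrt k) ≤ u j := by
  set e : EuclideanSpace ℝ V := WithLp.toLp 2 fun i => if i ∈ T then 1 / Real.sqrt k else (0 : ℝ)
    with hedef
  have hk0 : (0 : ℝ) < k := by exact_mod_cast hk
  have hsq : 0 < Real.sqrt k := Real.sqrt_pos.2 hk0
  have he : ‖e‖ = 1 := norm_indicator_div_sqrt hk hT
  -- `⟪u, e⟫ ≥ 1/2` by polarisation
  have hinner : 1 / 2 < ⟪u, e⟫_ℝ := by
    have hpol := norm_sub_sq_real u e
    rw [hu, he] at hpol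
    have h16 : ‖u - e‖ ^ 2 ≤ (1 / 16) ^ 2 := pow_le_pow_left₀ (norm_nonneg _) hue 2
    nlinarith
  -- `⟪u, e⟫ = (Σ_{j ∈ T} u j)/√k`
  have hsum : ⟪u, e⟫_ℝ = (∑ j ∈ T, u j) * (1 / Real.sqrt k) := by
    rw [euclidean_inner_eq, sum_mul]
    rw [← sum_filter_add_sum_filter_not univ (fun i => i ∈ T)]
    have hTf : univ.filter (fun i => i ∈ T) = T := by ext i; simp
    rw [hTf]
    have h0 : ∑ i ∈ univ.filter (fun i => ¬ i ∈ T), u i * e i = 0 := by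
      refine sum_eq_zero fun i hi => ?_
      have : e i = 0 := by simp [hedef, (mem_filter.1 hi).2]
      rw [this, mul_zero]
    rw [h0, add_zero]
    refine sum_congr rfl fun i hi => ?_
    have : e i = 1 / Real.sqrt k := by simp [hedef, hi]
    rw [this]
  by_contra hnone
  push Not at hnone
  have hTne : T.Nonempty := by rw [← card_pos, hT]; exact hk
  have hlt : ∑ j ∈ T, u j < ∑ _j ∈ T, 1 / (2 * Real.sqrt k) :=
    sum_lt_sum_of_nonempty hTne fun j hj => hnone j hj
  rw [sum_const, hT, nsmul_eq_mul] at hlt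
  have : ⟪u, e⟫_ℝ < k * (1 / (2 * Real.sqrt k)) * (1 / Real.sqrt k) := by
    rw [hsum]; exact mul_lt_mul_of_pos_right hlt (by positivity)
  have hk2 : (k : ℝ) * (1 / (2 * Real.sqrt k)) * (1 / Real.sqrt k) = 1 / 2 := by
    field_simp
    rw [Real.sq_sqrt hk0.le]
  linarith

/-! ### The power of the sign matrix as power iteration -/

/-- Column `j` of `Bᵗ` is `t` steps of power iteration from the `j`-th basis vector. [folklore] -/
theorem toEuclideanLin_pow_basis (M : Matrix V V ℝ) (t : ℕ) (j : V) :
    (Matrix.toEuclideanLin M ^ t) (WithLp.toLp 2 fun i => if i = j then (1 : ℝ) else 0) =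
      WithLp.toLp 2 fun i => (M ^ t) i j := by
  have hsingle : (fun i => if i = j then (1 : ℝ) else 0) = Pi.single j 1 := by
    ext i; simp [Pi.single_apply]
  rw [hsingle, Matrix.toEuclideanLin, ← Matrix.toLpLin_pow, Matrix.toLpLin_apply,
    WithLp.ofLp_toLp, Matrix.mulVec_single_one]
  rfl

/-! ### The deterministic core -/

/-- **Deterministic core of the AKS algorithm.** Let `T` be a clique of size `k` in `G`,
`B = signMatrix G`, and suppose: the random part is small (`Σ Rᵢⱼ aᵢ bⱼ ≤ ρ₀ ‖a‖ ‖b‖` with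
`Rᵢⱼ = 0` on `T × T`, `= Bᵢⱼ` otherwise), every vertex outside `T` has `< 7k/12` neighbours in
`T`, `k ≥ 64(ρ₀ + 1)` and `2ᵗ ≥ 32 √k`. Then there is `j ∈ T` such that for every `k`-set `W` of
coordinates of the column `Bᵗ eⱼ` dominating the remaining coordinates in absolute value, the
vertices with `≥ 3k/4` neighbours in `W` are exactly the vertices of `T`.
[cite: AlonKrivelevichSudakov1998, §2.2 (analysis of Algorithm A)] -/
theorem spectral_core (G : SimpleGraph V) [DecidableRel G.Adj] {k : ℕ} {T : Finset V}
    (hT : T.card = k) (hclique : G.IsClique (T : Set V)) {ρ₀ : ℝ} (hρ₀ : 0 ≤ ρ₀)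
    (hR : ∀ a b : EuclideanSpace ℝ V,
      ∑ i, ∑ j, (if i ∈ T ∧ j ∈ T then 0 else (signMatrix G).map (Int.cast : ℤ → ℝ) i j)
        * a i * b j ≤ ρ₀ * ‖a‖ * ‖b‖)
    (hdeg : ∀ v, v ∉ T → ((T.filter fun w => G.Adj v w).card : ℝ) < 7 * k / 12)
    (hk : 64 * (ρ₀ + 1) ≤ k) {t : ℕ} (ht : 32 * Real.sqrt k ≤ 2 ^ t) :
    ∃ j ∈ T, ∀ W : Finset V, W.card = k →
      (∀ i ∈ W, ∀ l, l ∉ W → |(signMatrix G ^ t) l j| ≤ |(signMatrix G ^ t) i j|) →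
      ((univ : Finset V).filter fun v => 3 * k ≤ 4 * (W.filter fun w => G.Adj v w).card) = T := by
  -- constants
  set ρ : ℝ := ρ₀ + 1 with hρdef
  have hρ1 : 1 ≤ ρ := by rw [hρdef]; linarith
  have hρ0 : 0 ≤ ρ := by linarith
  have hk64 : (64 : ℝ) ≤ k := le_trans (by nlinarith) hk
  have hk1 : 1 ≤ k := by
    have : (1 : ℝ) ≤ k := by linarith
    exact_mod_cast this
  have hk12 : 12 ≤ k := by
    have : (12 : ℝ) ≤ k := by linarith
    exact_mod_cast this
  have hk0 : (0 : ℝ) < k := by exact_mod_cast hk1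
  have hsq : 0 < Real.sqrt k := Real.sqrt_pos.2 hk0
  -- the operator, the spike direction, the spike bound
  set B := (signMatrix G).map (Int.cast : ℤ → ℝ) with hB
  set Tl := Matrix.toEuclideanLin B with hTl
  set e : EuclideanSpace ℝ V := WithLp.toLp 2 fun i => if i ∈ T then 1 / Real.sqrt k else (0 : ℝ)
    with hedef
  have hTsymm : Tl.IsSymmetric :=
    (Matrix.isSymmetric_toEuclideanLin_iff).2 (isHermitian_signMatrix_map G)
  have he : ‖e‖ = 1 := norm_indicator_div_sqrt hk1 hT
  have hM : ∀ a b : EuclideanSpace ℝ V, ⟪Tl a, b⟫_ℝ ≤ k * ⟪e, a⟫_ℝ * ⟪e, b⟫_ℝ + ρ * ‖a‖ * ‖b‖ :=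
    fun a b => spike_bound_signMatrix G hk1 hclique hR a b
  -- the top eigenvector
  obtain ⟨u, lam₁, hunorm, -, hlam₁, -, hue, hpow⟩ :=
    exists_top_eigenvector hTsymm he hρ0 hk0 (by linarith) hM
  have hρk : 4 * ρ / k ≤ 1 / 16 := by
    rw [div_le_div_iff₀ hk0 (by norm_num)]; linarith
  have hue' : ‖u - e‖ ≤ 1 / 16 := hue.trans hρk
  -- a good coordinate
  obtain ⟨j, hjT, huj⟩ := exists_coord_ge_of_norm_sub_le hk1 hT hunorm hue'
  have huj0 : 0 < u j := lt_of_lt_of_le (by positivity) huj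
  refine ⟨j, hjT, fun W hW htop => ?_⟩
  -- the column as power iteration
  set z₀ : EuclideanSpace ℝ V := WithLp.toLp 2 fun i => if i = j then (1 : ℝ) else 0 with hz₀
  have hz₀norm : ‖z₀‖ = 1 := by
    have h2 : ‖z₀‖ ^ 2 = 1 := by
      rw [EuclideanSpace.real_norm_sq_eq]
      have : ∀ i, (z₀ i) ^ 2 = if i = j then (1 : ℝ) else 0 := fun i => by
        simp only [hz₀, WithLp.ofLp_toLp]; split_ifs <;> simp
      simp_rw [this]
      rw [sum_ite_eq' univ j, if_pos (mem_univ _)]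
    rw [← Real.sqrt_sq (norm_nonneg _), h2, Real.sqrt_one]
  have huz₀ : ⟪u, z₀⟫_ℝ = u j := by
    rw [euclidean_inner_eq]
    have : ∀ i, u i * z₀ i = if i = j then u j else 0 := fun i => by
      simp only [hz₀, WithLp.ofLp_toLp]; split_ifs with h <;> simp [h]
    simp_rw [this]
    rw [sum_ite_eq' univ j, if_pos (mem_univ _)]
  have hY : (Tl ^ t) z₀ = WithLp.toLp 2 fun i => (B ^ t) i j := toEuclideanLin_pow_basis B t j
  -- the power iteration bound: `‖Y - c u‖ ≤ (2ρ)ᵗ`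
  set c : ℝ := lam₁ ^ t * u j with hc
  have hlam4 : 4 * ρ ≤ lam₁ := by linarith
  have hlampos : 0 < lam₁ := by linarith
  have hcpos : 0 < c := by positivity
  have hbound := hpow z₀ t
  rw [huz₀, hz₀norm, mul_one] at hbound
  -- `(2ρ)ᵗ ≤ c · 2√k / 2ᵗ`, hence `‖c⁻¹ Y - u‖ ≤ 2√k/2ᵗ ≤ 1/16`
  have hkey : (2 * ρ) ^ t * 2 ^ t ≤ c * (2 * Real.sqrt k) := by
    have h1 : (2 * ρ) ^ t * 2 ^ t = (4 * ρ) ^ t := by rw [← mul_pow]; ring_nf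
    have h2 : (4 * ρ) ^ t ≤ lam₁ ^ t := pow_le_pow_left₀ (by positivity) hlam4 t
    have h3 : 1 ≤ u j * (2 * Real.sqrt k) := by
      have := mul_le_mul_of_nonneg_right huj (show (0 : ℝ) ≤ 2 * Real.sqrt k by positivity)
      rwa [one_div, inv_mul_cancel₀ (by positivity)] at this
    calc (2 * ρ) ^ t * 2 ^ t = (4 * ρ) ^ t * 1 := by rw [h1, mul_one]
      _ ≤ lam₁ ^ t * (u j * (2 * Real.sqrt k)) :=
          mul_le_mul h2 h3 zero_le_one (by positivity)
      _ = c * (2 * Real.sqrt k) := by rw [hc]; ring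
  set zv : EuclideanSpace ℝ V := c⁻¹ • (Tl ^ t) z₀ with hzv
  have hzu : ‖zv - u‖ ≤ 1 / 16 := by
    have h1 : zv - u = c⁻¹ • ((Tl ^ t) z₀ - c • u) := by
      rw [hzv, smul_sub, smul_smul, inv_mul_cancel₀ hcpos.ne', one_smul]
    rw [h1, norm_smul, Real.norm_eq_abs, abs_of_pos (inv_pos.2 hcpos)]
    have h2 : c⁻¹ * ‖(Tl ^ t) z₀ - c • u‖ ≤ c⁻¹ * (2 * ρ) ^ t :=
      mul_le_mul_of_nonneg_left hbound (inv_pos.2 hcpos).le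
    refine h2.trans ?_
    have h2t : (0 : ℝ) < 2 ^ t := by positivity
    -- `c⁻¹ (2ρ)ᵗ ≤ 2√k / 2ᵗ ≤ 1/16`
    have h3 : c⁻¹ * (2 * ρ) ^ t ≤ 2 * Real.sqrt k / 2 ^ t := by
      rw [le_div_iff₀ h2t, mul_assoc, inv_mul_le_iff₀ hcpos]
      exact hkey
    refine h3.trans ?_
    rw [div_le_div_iff₀ h2t (by norm_num)]
    linarith
  have hze : ‖zv - e‖ ≤ 1 / 8 := by
    calc ‖zv - e‖ = ‖(zv - u) + (u - e)‖ := by rw [sub_add_sub_cancel]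
      _ ≤ ‖zv - u‖ + ‖u - e‖ := norm_add_le _ _
      _ ≤ 1 / 16 + 1 / 16 := add_le_add hzu hue'
      _ = 1 / 8 := by norm_num
  -- coordinates of `zv`
  have hzvi : ∀ i, zv i = c⁻¹ * ((signMatrix G ^ t) i j : ℝ) := by
    intro i
    rw [hzv, hY]
    simp only [PiLp.smul_apply, smul_eq_mul]
    rw [cast_signMatrix_pow_apply]
  -- selection
  have hzsum : ∑ i, (zv i - if i ∈ T then 1 / Real.sqrt k else 0) ^ 2 ≤ (1 / 8) ^ 2 := by
    have : ∑ i, (zv i - if i ∈ T then 1 / Real.sqrt k else 0) ^ 2 = ‖zv - e‖ ^ 2 := by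
      rw [EuclideanSpace.real_norm_sq_eq]
      refine sum_congr rfl fun i _ => ?_
      simp [hedef]
    rw [this]
    exact pow_le_pow_left₀ (norm_nonneg _) hze 2
  have htop' : ∀ i ∈ W, ∀ l, l ∉ W → |zv l| ≤ |zv i| := by
    intro i hi l hl
    rw [hzvi, hzvi, abs_mul, abs_mul, abs_of_pos (inv_pos.2 hcpos)]
    refine mul_le_mul_of_nonneg_left ?_ (inv_pos.2 hcpos).le
    have := htop i hi l hl
    rw [← Int.cast_abs, ← Int.cast_abs]
    exact Int.cast_le.2 this
  obtain ⟨hWT, hTW⟩ := card_sdiff_le_of_top_selection hk1 hT hW (fun i => zv i) hzsum htop'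
  have h96 : 9 * (k : ℝ) * (1 / 8) ^ 2 ≤ k / 6 := by nlinarith
  exact filter_threeQuarters_eq G hk12 hT hclique (hWT.trans h96) (hTW.trans h96) hdeg

end Literature.Probability.RandomGraphs.PlantedClique

end
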